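import Mathlib.GroupTheory.DoubleCoset
import Mathlib.MeasureTheory.Integral.Bochner.Set
import Mathlib.MeasureTheory.Constructions.BorelSpace.Basic
import Mathlib.Topology.Algebra.Group.Basic
import HarnessLib

/-!
# F0 · P3c · line LH6 «StCharTS» — road (D) «DEEP-FL», brick D2 «SHELL-KN»: the shells `K b K` of a dominant torus element for an IWAHORI-FACTORISED `K` —
# `K b K = (K ∩ N) · b · K`, the Borel fibres `{n ∈ N | t n ∈ K b K} = t⁻¹ (K ∩ N) t · 𝟙[t ∈ b (K ∩ T)]`, and the `N`-integral of the shell indicator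

Cell `pub/hodgecm-mathlib`, crux H413 = `stmt-HodgeConjecture-24833` (`--supports` lane, helper), route HCCMUnconditional; seat LH6-p04 (g2), road (D) «DEEP-FL»
(owner; desk F0P3b-plan (g23) ruling 2026-09-02T04:10:49Z (3)), interface `F0/P3b/LH6-p04/g2/ROAD-D.interface.txt` §3 D2.  THEOREMS ONLY (generic group
theory: any group `G`, subgroups `T, N, N̄, K`, element `b`; Mathlib only), sorry-free, no definition ∕ instance ∕ notation ∕ named fact.  HONEST LABEL: HC_CM is
proved only modulo the 7 printed citations (2 remaining: hLiu418 = stmt-HodgeConjecture-24832, h413 = stmt-HodgeConjecture-24833) until rung 0 closes;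
count-neutral; nothing about `U(3)` is asserted here.

THE MATHEMATICS (Iwahori–Matsumoto ∕ Bruhat–Tits bookkeeping behind «`T_a = e_K π(a) e_K`», [Casselman1995, Prop. 1.4.4, Lemma 1.5.1, §4.1]; [BushnellHenniart2006,
§4.1]; used by [Rogawski1990, §12.7 L. 12.7.3 proof p. 195] through Casselman's theorem on `M⁻`).  HYPOTHESES (all recorded by ★ `ParabolicTriple.IwahoriDatum` ∕ ★
R2d `JacquetRayShellTrace` or elementary on the model): `K = (K ∩ N̄)(K ∩ T)(K ∩ N)` as SETS (Iwahori factorisation); `T` normalises `N`; `T ∩ N = 1` and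
`N̄ ∩ T N = 1` (big-cell disjointness, which makes the factorisation of an element of `B ∩ K` UNIQUE); `b ∈ T` commutes with `K ∩ T` and is DOMINANT:
`b (K ∩ N) b⁻¹ ⊆ K`, `b⁻¹ (K ∩ N̄) b ⊆ K`.
* §1 `coe_eq_mul_mul_symm` — the factorisation in the opposite order `K = (K ∩ N)(K ∩ T)(K ∩ N̄)` (inverse map); `mem_borel_inter_iff` — UNIQUENESS: for `t ∈ T`,
  `n ∈ N`: `t n ∈ K ↔ t ∈ K ∧ n ∈ K`.
* §2 `doubleCoset_eq_inf_mul` — **`K b K = (K ∩ N) · b · K`**; `conj_mem_doubleCoset_iff` — `K`-conjugation invariance of the shell.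
* §3 `torus_mul_mem_doubleCoset_iff` — **THE FIBRE**: for `t ∈ T`, `n ∈ N`: `t n ∈ K b K ↔ b⁻¹ t ∈ K ∧ t n t⁻¹ ∈ K` (i.e. `t ∈ b (K ∩ T)` and `n ∈ t⁻¹ (K ∩ N) t`).
* §4 `integral_indicator_doubleCoset_torus_mul` — the `N`-INTEGRAL of the shell indicator along a Borel fibre:
  `∫_{N} 𝟙_{KbK}(t n) dμ_N = 𝟙[b⁻¹ t ∈ K] · μ_N {n ∈ N | t n t⁻¹ ∈ K}` (any measure `μ_N` on `N`; `K` open) — the `(K, N)`-transform of `𝟙_{K b K}` that the van Dijk ∕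
  orbital-integral torus forms (★ `exists_smoothTrace_cmPrincipalSeries_eq_integral_torus`, ★ `…cmPrincipalSeriesH_eq_integral_torus`) consume, after the trivial
  `K`-integral (§2 invariance).

## References
* [Casselman1995] W. Casselman, *Introduction to the theory of admissible representations of p-adic reductive groups* (1995 notes), Prop. 1.4.4, Lemma 1.5.1, §4.1.
* [BushnellHenniart2006] C. J. Bushnell, G. Henniart, *The Local Langlands Conjecture for GL(2)*, Grundlehren 335 (2006), §4.1.
* [Rogawski1990] J. D. Rogawski, *Automorphic Representations of Unitary Groups in Three Variables*, Ann. of Math. Stud. 123 (1990), §12.7 p. 195; §1.10 p. 9.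
-/

set_option autoImplicit false
-- the mandated namespace has the single-problem summit's repeated segment (`HodgeConjecture.HodgeConjecture`)
set_option linter.dupNamespace false

open MeasureTheory
open scoped Pointwise

namespace Summit.HodgeConjecture.HodgeConjecture.Cruxes.H413.F0P3cStCharTSShellKN

variable {G : Type*} [Group G] (T N Nbar K : Subgroup G)

/-! ## §1 The Iwahori factorisation in the opposite order; uniqueness on the Borel -/

/-- From `K = (K ∩ N̄)(K ∩ T)(K ∩ N)` (as sets) to `K = (K ∩ N)(K ∩ T)(K ∩ N̄)` (take inverses). [cite: Casselman1995, Prop. 1.4.4] -/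
theorem coe_eq_mul_mul_symm
    (hK : (K : Set G) = ((K ⊓ Nbar : Subgroup G) : Set G) * ((K ⊓ T : Subgroup G) : Set G) * ((K ⊓ N : Subgroup G) : Set G)) :
    (K : Set G) = ((K ⊓ N : Subgroup G) : Set G) * ((K ⊓ T : Subgroup G) : Set G) * ((K ⊓ Nbar : Subgroup G) : Set G) := by
  ext x
  constructor
  · intro hx
    have hx' : x⁻¹ ∈ (K : Set G) := K.inv_mem hx
    rw [hK] at hx'
    obtain ⟨y, hy, n, hn, hxy⟩ := Set.mem_mul.1 hx'
    obtain ⟨nb, hnb, t, ht, rfl⟩ := Set.mem_mul.1 hy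
    have hxeq : x = n⁻¹ * t⁻¹ * nb⁻¹ := by
      rw [← inv_inv x, ← hxy]
      simp only [mul_inv_rev, mul_assoc]
    rw [hxeq]
    exact Set.mem_mul.2 ⟨n⁻¹ * t⁻¹, Set.mem_mul.2 ⟨n⁻¹, inv_mem hn, t⁻¹, inv_mem ht, rfl⟩, nb⁻¹, inv_mem hnb, rfl⟩
  · intro hx
    obtain ⟨y, hy, nb, hnb, rfl⟩ := Set.mem_mul.1 hx
    obtain ⟨n, hn, t, ht, rfl⟩ := Set.mem_mul.1 hy
    exact K.mul_mem (K.mul_mem (Subgroup.mem_inf.1 hn).1 (Subgroup.mem_inf.1 ht).1) (Subgroup.mem_inf.1 hnb).1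

/-- **Uniqueness on the Borel**: if `T` normalises `N`, `T ∩ N = 1` and `N̄ ∩ T N = 1`, then for `t ∈ T`, `n ∈ N`: `t n ∈ K ↔ t ∈ K ∧ n ∈ K`
(`K` Iwahori-factorised). [cite: Casselman1995, Prop. 1.4.4] -/
theorem mem_borel_inter_iff
    (hK : (K : Set G) = ((K ⊓ Nbar : Subgroup G) : Set G) * ((K ⊓ T : Subgroup G) : Set G) * ((K ⊓ N : Subgroup G) : Set G))
    (hTN : ∀ t ∈ T, ∀ n ∈ N, t * n * t⁻¹ ∈ N) (hTNi : ∀ x ∈ T, x ∈ N → x = 1)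
    (hNbar : ∀ x ∈ Nbar, ∀ t ∈ T, ∀ n ∈ N, x = t * n → x = 1)
    {t n : G} (ht : t ∈ T) (hn : n ∈ N) : t * n ∈ K ↔ t ∈ K ∧ n ∈ K := by
  constructor
  · intro htn
    have htn' : t * n ∈ (K : Set G) := htn
    rw [hK] at htn'
    obtain ⟨y, hy, n₂, hn₂, hxy⟩ := Set.mem_mul.1 htn'
    obtain ⟨nb, hnb, t₂, ht₂, rfl⟩ := Set.mem_mul.1 hy
    have hnb' := (Subgroup.mem_inf.1 hnb)
    have ht₂' := (Subgroup.mem_inf.1 ht₂)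
    have hn₂' := (Subgroup.mem_inf.1 hn₂)
    -- `nb = t n n₂⁻¹ t₂⁻¹ = (t t₂⁻¹) · (t₂ (n n₂⁻¹) t₂⁻¹) ∈ T N`, hence `nb = 1`
    have hnb_eq : nb = (t * t₂⁻¹) * (t₂ * (n * n₂⁻¹) * t₂⁻¹) := by
      have : nb = t * n * n₂⁻¹ * t₂⁻¹ := by rw [← hxy]; group
      rw [this]; group
    have hnb1 : nb = 1 :=
      hNbar nb hnb'.2 _ (T.mul_mem ht (T.inv_mem ht₂'.2)) _ (hTN t₂ ht₂'.2 _ (N.mul_mem hn (N.inv_mem hn₂'.2))) hnb_eq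
    rw [hnb1, one_mul] at hxy
    -- `t₂ n₂ = t n` ⇒ `t⁻¹ t₂ = n n₂⁻¹ ∈ T ∩ N` ⇒ `t = t₂`, `n = n₂`
    have hq : t⁻¹ * t₂ = n * n₂⁻¹ := by
      have := hxy
      calc t⁻¹ * t₂ = t⁻¹ * (t₂ * n₂) * n₂⁻¹ := by group
        _ = t⁻¹ * (t * n) * n₂⁻¹ := by rw [this]
        _ = n * n₂⁻¹ := by group
    have h1 : t⁻¹ * t₂ = 1 :=
      hTNi _ (T.mul_mem (T.inv_mem ht) ht₂'.2) (by rw [hq]; exact N.mul_mem hn (N.inv_mem hn₂'.2))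
    have ht_eq : t = t₂ := by
      have := congrArg (t * ·) h1
      simp only [mul_inv_cancel_left, mul_one] at this
      exact this.symm
    have hn_eq : n = n₂ := by
      have h2 : n * n₂⁻¹ = 1 := by rw [← hq, h1]
      have := congrArg (· * n₂) h2
      simpa using this
    exact ⟨ht_eq ▸ ht₂'.1, hn_eq ▸ hn₂'.1⟩
  · rintro ⟨htK, hnK⟩
    exact K.mul_mem htK hnK

/-! ## §2 `K b K = (K ∩ N) · b · K` and `K`-conjugation invariance -/

/-- **`K b K = (K ∩ N) · b · K`** for `K` Iwahori-factorised and `b` DOMINANT (`b` commutes with `K ∩ T`, `b⁻¹ (K ∩ N̄) b ⊆ K`): writing `k = n t n̄`,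
`k b k′ = n · b · (t (b⁻¹ n̄ b) k′)`. [cite: Casselman1995, Lemma 1.5.1, §4.1] [cite: BushnellHenniart2006, §4.1] -/
theorem doubleCoset_eq_inf_mul
    (hK : (K : Set G) = ((K ⊓ Nbar : Subgroup G) : Set G) * ((K ⊓ T : Subgroup G) : Set G) * ((K ⊓ N : Subgroup G) : Set G))
    {b : G} (hbT : ∀ t ∈ K ⊓ T, t * b = b * t) (hD2 : ∀ x ∈ K ⊓ Nbar, b⁻¹ * x * b ∈ K) :
    DoubleCoset.doubleCoset b (K : Set G) K = DoubleCoset.doubleCoset b ((K ⊓ N : Subgroup G) : Set G) K := by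
  ext x
  rw [DoubleCoset.mem_doubleCoset, DoubleCoset.mem_doubleCoset]
  constructor
  · rintro ⟨k, hk, k', hk', rfl⟩
    have hk₀ : k ∈ (K : Set G) := hk
    rw [coe_eq_mul_mul_symm T N Nbar K hK] at hk₀
    obtain ⟨y, hy, nb, hnb, rfl⟩ := Set.mem_mul.1 hk₀
    obtain ⟨n, hn, t, ht, rfl⟩ := Set.mem_mul.1 hy
    refine ⟨n, hn, t * (b⁻¹ * nb * b) * k', K.mul_mem (K.mul_mem (Subgroup.mem_inf.1 ht).1 (hD2 nb hnb)) hk', ?_⟩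
    have htb : t * b = b * t := hbT t ht
    calc n * t * nb * b * k' = n * (t * b) * (b⁻¹ * nb * b) * k' := by group
      _ = n * (b * t) * (b⁻¹ * nb * b) * k' := by rw [htb]
      _ = n * b * (t * (b⁻¹ * nb * b) * k') := by group
  · rintro ⟨n, hn, k', hk', rfl⟩
    exact ⟨n, (Subgroup.mem_inf.1 hn).1, k', hk', rfl⟩

/-- The shell is `K`-conjugation invariant: `k x k⁻¹ ∈ K b K ↔ x ∈ K b K` for `k ∈ K`. [cite: Casselman1995, §4.1] -/
theorem conj_mem_doubleCoset_iff {b k x : G} (hk : k ∈ K) :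
    k * x * k⁻¹ ∈ DoubleCoset.doubleCoset b (K : Set G) K ↔ x ∈ DoubleCoset.doubleCoset b (K : Set G) K := by
  rw [DoubleCoset.mem_doubleCoset, DoubleCoset.mem_doubleCoset]
  constructor
  · rintro ⟨k₁, hk₁, k₂, hk₂, h⟩
    refine ⟨k⁻¹ * k₁, K.mul_mem (K.inv_mem hk) hk₁, k₂ * k, K.mul_mem hk₂ hk, ?_⟩
    calc x = k⁻¹ * (k * x * k⁻¹) * k := by group
      _ = k⁻¹ * (k₁ * b * k₂) * k := by rw [h]
      _ = k⁻¹ * k₁ * b * (k₂ * k) := by group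
  · rintro ⟨k₁, hk₁, k₂, hk₂, rfl⟩
    exact ⟨k * k₁, K.mul_mem hk hk₁, k₂ * k⁻¹, K.mul_mem hk₂ (K.inv_mem hk), by group⟩

/-! ## §3 The Borel fibres of the shell -/

/-- **THE FIBRE OF THE SHELL OVER THE TORUS.**  `K` Iwahori-factorised, `T` normalises `N`, `T ∩ N = 1`, `N̄ ∩ TN = 1`; `b ∈ T` commutes with `K ∩ T` and is
dominant (`b (K ∩ N) b⁻¹ ⊆ K`, `b⁻¹ (K ∩ N̄) b ⊆ K`).  Then for `t ∈ T`, `n ∈ N`: **`t n ∈ K b K ↔ b⁻¹ t ∈ K ∧ t n t⁻¹ ∈ K`** — the shell meets the Borel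
coset `t N` iff `t ∈ b (K ∩ T)`, and then in `t · t⁻¹(K ∩ N) t`. [cite: Casselman1995, Lemma 1.5.1, §4.1] [cite: BushnellHenniart2006, §4.1] -/
theorem torus_mul_mem_doubleCoset_iff
    (hK : (K : Set G) = ((K ⊓ Nbar : Subgroup G) : Set G) * ((K ⊓ T : Subgroup G) : Set G) * ((K ⊓ N : Subgroup G) : Set G))
    (hTN : ∀ t ∈ T, ∀ n ∈ N, t * n * t⁻¹ ∈ N) (hTNi : ∀ x ∈ T, x ∈ N → x = 1)
    (hNbar : ∀ x ∈ Nbar, ∀ t ∈ T, ∀ n ∈ N, x = t * n → x = 1)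
    {b : G} (hb : b ∈ T) (hbT : ∀ t ∈ K ⊓ T, t * b = b * t)
    (hD1 : ∀ x ∈ K ⊓ N, b * x * b⁻¹ ∈ K) (hD2 : ∀ x ∈ K ⊓ Nbar, b⁻¹ * x * b ∈ K)
    {t n : G} (ht : t ∈ T) (hn : n ∈ N) :
    t * n ∈ DoubleCoset.doubleCoset b (K : Set G) K ↔ b⁻¹ * t ∈ K ∧ t * n * t⁻¹ ∈ K := by
  constructor
  · intro h
    rw [doubleCoset_eq_inf_mul T N Nbar K hK hbT hD2, DoubleCoset.mem_doubleCoset] at h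
    obtain ⟨n₁, hn₁, k, hk, hk_eq⟩ := h
    have hn₁' := Subgroup.mem_inf.1 hn₁
    -- `k = (b⁻¹ t) · (t⁻¹ n₁⁻¹ t · n)` ∈ `T N`
    have ht' : b⁻¹ * t ∈ T := T.mul_mem (T.inv_mem hb) ht
    have hn' : t⁻¹ * n₁⁻¹ * t * n ∈ N := by
      have := hTN t⁻¹ (T.inv_mem ht) n₁⁻¹ (N.inv_mem hn₁'.2)
      rw [inv_inv] at this
      exact N.mul_mem this hn
    have hk' : k = (b⁻¹ * t) * (t⁻¹ * n₁⁻¹ * t * n) := by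
      calc k = b⁻¹ * n₁⁻¹ * (n₁ * b * k) := by group
        _ = b⁻¹ * n₁⁻¹ * (t * n) := by rw [← hk_eq]
        _ = (b⁻¹ * t) * (t⁻¹ * n₁⁻¹ * t * n) := by group
    have hboth := (mem_borel_inter_iff T N Nbar K hK hTN hTNi hNbar ht' hn').1 (hk' ▸ hk)
    refine ⟨hboth.1, ?_⟩
    -- `t n t⁻¹ = n₁ · b ((b⁻¹t) (t⁻¹ n₁⁻¹ t n) (b⁻¹t)⁻¹) b⁻¹`
    have hinner : (b⁻¹ * t) * (t⁻¹ * n₁⁻¹ * t * n) * (b⁻¹ * t)⁻¹ ∈ K ⊓ N :=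
      Subgroup.mem_inf.2 ⟨K.mul_mem (K.mul_mem hboth.1 hboth.2) (K.inv_mem hboth.1), hTN _ ht' _ hn'⟩
    have hconj := hD1 _ hinner
    have heq : t * n * t⁻¹ = n₁ * (b * ((b⁻¹ * t) * (t⁻¹ * n₁⁻¹ * t * n) * (b⁻¹ * t)⁻¹) * b⁻¹) := by group
    rw [heq]
    exact K.mul_mem hn₁'.1 hconj
  · rintro ⟨hbt, htnt⟩
    rw [DoubleCoset.mem_doubleCoset]
    refine ⟨t * n * t⁻¹, htnt, b⁻¹ * t, hbt, ?_⟩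
    group

/-- The fibre in «coset» words: under the hypotheses of `torus_mul_mem_doubleCoset_iff`, if `b⁻¹ t ∉ K` the Borel coset `t N` misses the shell.
[cite: Casselman1995, Lemma 1.5.1] -/
theorem torus_mul_not_mem_doubleCoset
    (hK : (K : Set G) = ((K ⊓ Nbar : Subgroup G) : Set G) * ((K ⊓ T : Subgroup G) : Set G) * ((K ⊓ N : Subgroup G) : Set G))
    (hTN : ∀ t ∈ T, ∀ n ∈ N, t * n * t⁻¹ ∈ N) (hTNi : ∀ x ∈ T, x ∈ N → x = 1)
    (hNbar : ∀ x ∈ Nbar, ∀ t ∈ T, ∀ n ∈ N, x = t * n → x = 1)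
    {b : G} (hb : b ∈ T) (hbT : ∀ t ∈ K ⊓ T, t * b = b * t)
    (hD1 : ∀ x ∈ K ⊓ N, b * x * b⁻¹ ∈ K) (hD2 : ∀ x ∈ K ⊓ Nbar, b⁻¹ * x * b ∈ K)
    {t n : G} (ht : t ∈ T) (hn : n ∈ N) (hbt : b⁻¹ * t ∉ K) :
    t * n ∉ DoubleCoset.doubleCoset b (K : Set G) K := fun h =>
  hbt ((torus_mul_mem_doubleCoset_iff T N Nbar K hK hTN hTNi hNbar hb hbT hD1 hD2 ht hn).1 h).1

/-! ## §4 The `N`-integral of the shell indicator along a Borel fibre -/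

/-- **THE `N`-INTEGRAL OF `𝟙_{KbK}` ALONG `t N`**: for `t ∈ T` and any measure `μ_N` on `N`,
`∫_N 𝟙_{KbK}(t n) dμ_N = 𝟙[b⁻¹ t ∈ K] · μ_N {n ∈ N | t n t⁻¹ ∈ K}` (`K` open, so the fibre is measurable).  With the `K`-invariance of §2 this is the
`(K, N)`-transform of the shell indicator consumed by the torus forms of van Dijk's formula and of the split-torus orbital integrals.
[cite: Casselman1995, Lemma 1.5.1, §4.1] [cite: Rogawski1990, §12.7 L. 12.7.3 (proof) p. 195] -/
theorem integral_indicator_doubleCoset_torus_mul [TopologicalSpace G] [IsTopologicalGroup G] [MeasurableSpace ↥N] [BorelSpace ↥N]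
    (hK : (K : Set G) = ((K ⊓ Nbar : Subgroup G) : Set G) * ((K ⊓ T : Subgroup G) : Set G) * ((K ⊓ N : Subgroup G) : Set G))
    (hKo : IsOpen (K : Set G))
    (hTN : ∀ t ∈ T, ∀ n ∈ N, t * n * t⁻¹ ∈ N) (hTNi : ∀ x ∈ T, x ∈ N → x = 1)
    (hNbar : ∀ x ∈ Nbar, ∀ t ∈ T, ∀ n ∈ N, x = t * n → x = 1)
    {b : G} (hb : b ∈ T) (hbT : ∀ t ∈ K ⊓ T, t * b = b * t)
    (hD1 : ∀ x ∈ K ⊓ N, b * x * b⁻¹ ∈ K) (hD2 : ∀ x ∈ K ⊓ Nbar, b⁻¹ * x * b ∈ K)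
    (μN : Measure ↥N) {t : G} (ht : t ∈ T) [Decidable (b⁻¹ * t ∈ K)] :
    ∫ n : ↥N, (DoubleCoset.doubleCoset b (K : Set G) K).indicator (fun _ => (1 : ℂ)) (t * (n : G)) ∂μN =
      if b⁻¹ * t ∈ K then (μN.real {n : ↥N | t * (n : G) * t⁻¹ ∈ K} : ℂ) else 0 := by
  have hmeas : MeasurableSet {n : ↥N | t * (n : G) * t⁻¹ ∈ K} :=
    (hKo.preimage ((continuous_const.mul continuous_subtype_val).mul continuous_const)).measurableSet
  have hpt : ∀ n : ↥N, (DoubleCoset.doubleCoset b (K : Set G) K).indicator (fun _ => (1 : ℂ)) (t * (n : G)) =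
      if b⁻¹ * t ∈ K then {n : ↥N | t * (n : G) * t⁻¹ ∈ K}.indicator (fun _ => (1 : ℂ)) n else 0 := by
    intro n
    have hiff := torus_mul_mem_doubleCoset_iff T N Nbar K hK hTN hTNi hNbar hb hbT hD1 hD2 ht n.2
    by_cases hbt : b⁻¹ * t ∈ K
    · rw [if_pos hbt]
      by_cases hn : t * (n : G) * t⁻¹ ∈ K
      · rw [Set.indicator_of_mem (hiff.2 ⟨hbt, hn⟩), Set.indicator_of_mem (show n ∈ {n : ↥N | t * (n : G) * t⁻¹ ∈ K} from hn)]
      · rw [Set.indicator_of_notMem (fun h => hn (hiff.1 h).2), Set.indicator_of_notMem (show n ∉ {n : ↥N | t * (n : G) * t⁻¹ ∈ K} from hn)]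
    · rw [if_neg hbt, Set.indicator_of_notMem (fun h => hbt (hiff.1 h).1)]
  simp_rw [hpt]
  by_cases hbt : b⁻¹ * t ∈ K
  · simp_rw [if_pos hbt]
    rw [integral_indicator_const (1 : ℂ) hmeas, Complex.real_smul, mul_one]
  · simp_rw [if_neg hbt]
    rw [integral_zero]

end Summit.HodgeConjecture.HodgeConjecture.Cruxes.H413.F0P3cStCharTSShellKN
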